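import Literature.Probability.RandomPlanarGeometry.SelfAvoidingWalk
import HarnessLib

/-!
# The random-walk loop measure of a subgraph of `ℤ²`, the loop-soup void probability, and the
# loop-erased random walk law on a discrete domain

Topic `Probability/LatticeModels`; definition item `defn-RandomWalkLoopMeasure` (route
CriticalPhenomena/SAWLoopAvoidanceChaos: cruxes `ChaosExists` … `LatticeIsChaos`, support item
`LoopErasureIdentity`; idea card charge-continuation-from-lerw-lambda-saw).

Setting (Lawler 2018, §2): a finite set of vertices `A` with a weight `q` on directed edges; here
`A` = the vertices of a subgraph `G` of `ℤ²` (`Site 2`, in practice `G = discreteDomainGraph Ω δ`,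
the discrete domain `Ω_δ`), and `q` = the **Type II simple-random-walk weight** `q(x, y) = 1/4`
on the edges of `G` ("simple random walk in `ℤ^d` … viewed … as a Type II walk with `n = 2d`",
loc. cit.): the walk killed when it attempts a step that is not an edge of `G`. A path `ω` gets
weight `q(ω) = (1/4)^{|ω|}`.

* `rwLoopMass G W` — the **random-walk loop measure of the loops of `G` meeting `W`**:
  `m[ℒ(A; W)] = ∑_{l rooted loop, |l| > 0, l ∩ W ≠ ∅} q(l)/|l|` (Lawler 2018, Def. 8: rooted loop
  measure `m̃(l) = q(l)/|l|`; Def. 10 and the remark after it: summing `m̃` over the rooted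
  representatives gives the unrooted measure `m`, and "meets `W`" is a property of the unrooted
  loop; Lawler–Trujillo Ferreras 2007 for `ℤ²`). WRITTEN VERBATIM as the `tsum` inlined (five
  times, as `mass ε W`) in the items of route SAWLoopAvoidanceChaos, so that
  `rwLoopMass (discreteDomainGraph Ω ε) W` is definitionally that term.
* `rwLoopFactor G W = exp (rwLoopMass G W)` — Lawler's `F_W(A)` in its loop-measure form
  (Lawler 2018, Prop. 5.2: `F_B(A) = exp m[ℒ(A;B)]`, `= ∏ G_{A_j}(x_j,x_j)` (Def. 3),
  `F(A) = det G_A = 1/det(I - Q)` (Prop. 3.5)); `loopSoupVoid G W = exp (- rwLoopMass G W)` — the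
  probability that the unit-intensity random-walk loop soup on `G` contains no loop meeting `W`
  (Lawler 2018, §5.2, Def. 12: Poisson realisation of `m`).
* `rwGreen G a b = ∑_{ω : a → b} (1/4)^{|ω|}` — the Green's function `G_A(a, b)` of the killed walk
  (Lawler 2018, §2), in `ℝ≥0∞` (always defined; finite iff the killed walk is transient between
  `a` and `b`, e.g. on every finite `Ω_δ` with a killing edge — not proved here).
* `LERW.weight Ω δ a b` and `LERW.law Ω δ a b : Measure (SAW.DomainSAW Ω δ a b)` — the
  **loop-erased measure** `q̂(η) = ∑_{ω : a → b, LE(ω) = η} q(ω)` (Lawler 2018, §3, display before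
  Prop. 3.1) and its normalisation `q̂/G_A(a,b)`, the law of the loop erasure of the random walk
  from `a` to `b` in `Ω_δ`. As in the route, `LE` is Mathlib's `SimpleGraph.Walk.bypass`
  (loop erasure in reverse-chronological order; the chronological `loopErase` of
  `RandomPlanarGeometry/LoopErasure.lean` acts on vertex lists). By Lawler 2018 Prop. 3.4 with
  Prop. 5.2, `q̂(η) = q(η) F_η(A) = 4^{-|η|} exp (rwLoopMass Ω_δ η)` for chronological erasure, and
  the right-hand side does not depend on the erasure order (Lawler 1991, Lemma 7.2.1: `LE(ω)` and
  the reversal of `LE(ω^R)` have the same law) — this identity, in the `bypass` rendering, is the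
  route's support item `LoopErasureIdentity` (stmt-CriticalPhenomena-4526) and is NOT asserted
  here; dividing by `rwGreen` it reads `LERW.law {η} = 4^{-|η|} F_η(Ω_δ) / G_{Ω_δ}(a, b)`.

API proved here: unfolding lemmas (`rfl`), `rwLoopMass_nonneg`, `rwLoopMass_empty`,
monotonicity in `W` under summability (`rwLoopMass_mono`), `loopSoupVoid ∈ (0, 1]`,
`LERW.weight_singleton`, the total mass `LERW.weight_univ = rwGreen` (the fibres of `bypass`
partition the walks `a → b`), and `LERW.isProbabilityMeasure_law` when `0 < G(a,b) < ∞`.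

NOT here (rider lemmas for the route's provers, or later discharges): summability of the loop
series and finiteness of `rwGreen` on finite killed domains (spectral radius of the killed walk
`< 1`), the determinant formula `exp (rwLoopMass G W) = det(I - Q_{A∖W}) / det(I - Q_A)`
(Lawler 2018 Prop. 3.5 / Lawler–Limic 2010 Lemma 9.3.2), and `LoopErasureIdentity` itself.
Junk conventions: `rwLoopMass` is a real `tsum` (value `0` if the series diverges, e.g. on all of
`ℤ²`); `LERW.law = 0` if no walk joins `a` to `b` in `Ω_δ` or if `rwGreen = ∞`.

## References

* G. F. Lawler, *Topics in loop measures and the loop-erased walk*, Probab. Surveys 15 (2018)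
  28–101, arXiv:1709.07531 (arXiv numbering): §2 (weights, Type II simple random walk, Green's
  function), §3 (`q̂`, Prop. 3.1, Def. 3, Prop. 3.4, Prop. 3.5), §5.1 (Def. 8, Def. 10, Prop. 5.2),
  §5.2 (Def. 12, soups). [Lawler2018]
* G. F. Lawler, J. Trujillo Ferreras, *Random walk loop soup*, Trans. AMS 359 (2007) 767–787
  (the rooted measure `(1/4)^{|l|}/|l|` on `ℤ²`). [LawlerTrujilloferreras2006]
* G. F. Lawler, V. Limic, *Random Walk: A Modern Introduction*, CUP (2010), Ch. 9 (Lemma 9.3.2,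
  Prop. 9.5.1). [LawlerLimic2010]
* G. F. Lawler, *Intersections of Random Walks* (1991), Lemma 7.2.1 (reversal). [Lawler1991]
* M. Kozdron, G. F. Lawler (2007); T. Kennedy, G. F. Lawler (2013), §1.1 (the `λ`-SAW dictionary
  `c = 0 ↔ c = -2`). [KozdronLawler2007] [KennedyLawler2013]
-/

noncomputable section

open MeasureTheory Literature.Probability.RandomPlanarGeometry
open scoped ENNReal Classical

namespace Literature.Probability.LatticeModels

/-! ### The loop measure of the loops meeting a set -/

/-- The summand of the loop series: a rooted loop `l` of `G` (a closed walk at some vertex) of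
positive length meeting `W` contributes `m̃(l) = q(l)/|l| = (1/4)^{|l|}/|l|`, every other rooted
loop contributes `0`. (Lawler 2018, Def. 8 with the Type II simple-random-walk weight `q = 1/4` of
§2.) [cite: Lawler2018, Definition 8] -/
def rwLoopTerm (G : SimpleGraph (Site 2)) (W : Set (Site 2)) (p : Σ x : Site 2, G.Walk x x) : ℝ :=
  if 0 < p.2.length ∧ (∃ v ∈ p.2.support, v ∈ W) then
    ((1 : ℝ) / 4) ^ p.2.length / (p.2.length : ℝ) else 0

/-- The **random-walk loop measure of the set of loops of `G` that meet `W`**,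
`m[ℒ(A; W)] = ∑_{l : rooted loops of G, |l| > 0, l meets W} (1/4)^{|l|} / |l|` — the rooted loop
measure `m̃(l) = q(l)/|l|` (Lawler 2018, Def. 8) of the Type II simple random walk on `G ≤ ℤ²`
(`q = 1/4` per step, killed off `G`), summed over the rooted loops meeting `W`, which is the
unrooted loop measure of `ℒ(A; W)` (Def. 10). Written verbatim as the `tsum` `mass ε W` inlined in
the items of route CriticalPhenomena/SAWLoopAvoidanceChaos (with `G = discreteDomainGraph Ω ε`), to
which it is definitionally equal. A real `tsum`: junk value `0` if the series diverges (it
converges on finite killed domains; not proved here). [cite: Lawler2018, Definition 8 and Definition 10] -/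
def rwLoopMass (G : SimpleGraph (Site 2)) (W : Set (Site 2)) : ℝ :=
  ∑' p : (Σ x : Site 2, G.Walk x x),
    (if 0 < p.2.length ∧ (∃ v ∈ p.2.support, v ∈ W) then
      ((1 : ℝ) / 4) ^ p.2.length / (p.2.length : ℝ) else 0)

/-- Lawler's **`F_W(A)` in loop-measure form**: `exp m[ℒ(A; W)]` (Lawler 2018, Prop. 5.2:
`F_B(A) = exp{m[ℒ(A;B)]}`, equal to `∏_j G_{A_j}(x_j, x_j)` of Def. 3 and, for `B = A`, to
`det G_A = 1/det(I - Q)` of Prop. 3.5). [cite: Lawler2018, Proposition 5.2] -/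
def rwLoopFactor (G : SimpleGraph (Site 2)) (W : Set (Site 2)) : ℝ :=
  Real.exp (rwLoopMass G W)

/-- The **loop-soup void probability**: `exp(-m[ℒ(A; W)])`, the probability that the Poisson
realisation at intensity `1` of the loop measure (the random-walk loop soup on `G`, Lawler 2018
§5.2 Def. 12) contains no loop meeting `W`. [cite: Lawler2018, Definition 12] -/
def loopSoupVoid (G : SimpleGraph (Site 2)) (W : Set (Site 2)) : ℝ :=
  Real.exp (-rwLoopMass G W)

/-- The **Green's function** of the Type II simple random walk killed off `G`:
`G_A(a, b) = ∑_{ω ∈ 𝒦_A(a,b)} q(ω) = ∑_{ω : a → b in G} (1/4)^{|ω|}` (Lawler 2018, §2), valued in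
`ℝ≥0∞` so that it is always defined (finite iff the series converges). [cite: Lawler2018, §2 (Green's function)] -/
def rwGreen (G : SimpleGraph (Site 2)) (a b : Site 2) : ℝ≥0∞ :=
  ∑' ω : G.Walk a b, ((1 : ℝ≥0∞) / 4) ^ ω.length

/-! ### Unfolding and elementary properties -/

variable (G : SimpleGraph (Site 2)) (W : Set (Site 2))

/-- `rwLoopMass` is the sum of `rwLoopTerm`. [folklore] -/
theorem rwLoopMass_eq_tsum : rwLoopMass G W = ∑' p, rwLoopTerm G W p := rfl

/-- Each term of the loop series is nonnegative. [folklore] -/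
theorem rwLoopTerm_nonneg (p : Σ x : Site 2, G.Walk x x) : 0 ≤ rwLoopTerm G W p := by
  unfold rwLoopTerm
  split_ifs
  · positivity
  · exact le_rfl

/-- The terms are monotone in the set `W`. [folklore] -/
theorem rwLoopTerm_mono {W W' : Set (Site 2)} (h : W ⊆ W') (p : Σ x : Site 2, G.Walk x x) :
    rwLoopTerm G W p ≤ rwLoopTerm G W' p := by
  unfold rwLoopTerm
  by_cases hp : 0 < p.2.length ∧ ∃ v ∈ p.2.support, v ∈ W
  · obtain ⟨hl, v, hv, hvW⟩ := hp
    rw [if_pos ⟨hl, v, hv, hvW⟩, if_pos ⟨hl, v, hv, h hvW⟩]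
  · rw [if_neg hp]
    split_ifs
    · positivity
    · exact le_rfl

/-- No loop meets the empty set: every term vanishes. [folklore] -/
theorem rwLoopTerm_empty (p : Σ x : Site 2, G.Walk x x) : rwLoopTerm G ∅ p = 0 := by
  unfold rwLoopTerm
  rw [if_neg]
  rintro ⟨-, v, -, hv⟩
  exact hv

/-- The loop measure of a set of loops is nonnegative (also in the junk case). [folklore] -/
theorem rwLoopMass_nonneg : 0 ≤ rwLoopMass G W :=
  tsum_nonneg (rwLoopTerm_nonneg G W)

/-- `m[ℒ(A; ∅)] = 0`. [folklore] -/
@[simp] theorem rwLoopMass_empty : rwLoopMass G ∅ = 0 := by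
  rw [rwLoopMass_eq_tsum]
  simp [rwLoopTerm_empty]

/-- Monotonicity `W ⊆ W' ⇒ m[ℒ(A;W)] ≤ m[ℒ(A;W')]`, given summability of the larger series (the
smaller one is then summable by comparison). [folklore] -/
theorem rwLoopMass_mono {W W' : Set (Site 2)} (h : W ⊆ W') (hs : Summable (rwLoopTerm G W')) :
    rwLoopMass G W ≤ rwLoopMass G W' := by
  rw [rwLoopMass_eq_tsum, rwLoopMass_eq_tsum]
  exact (hs.of_nonneg_of_le (rwLoopTerm_nonneg G W) (rwLoopTerm_mono G h)).tsum_le_tsum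
    (rwLoopTerm_mono G h) hs

/-- The loop series does not depend on the `Decidable` instances inside its summand (any two
`Decidable` instances of a proposition agree), so every syntactic variant of the inlined `tsum`
is `rwLoopMass`. [folklore] -/
theorem tsum_ite_eq_rwLoopMass
    (inst : ∀ p : (Σ x : Site 2, G.Walk x x), Decidable (0 < p.2.length ∧ ∃ v ∈ p.2.support, v ∈ W)) :
    (∑' p : (Σ x : Site 2, G.Walk x x),
      @ite ℝ (0 < p.2.length ∧ ∃ v ∈ p.2.support, v ∈ W) (inst p)
        (((1 : ℝ) / 4) ^ p.2.length / (p.2.length : ℝ)) 0) = rwLoopMass G W := by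
  unfold rwLoopMass
  refine tsum_congr fun p => ?_
  split_ifs <;> rfl

/-- The loop mass of the loops meeting the vertices of a LIST `l` (e.g. the support of a SAW, as
in item `LoopErasureIdentity` of route SAWLoopAvoidanceChaos, where list membership is decidable)
is `rwLoopMass G {v | v ∈ l}`. [folklore] -/
theorem tsum_loops_meeting_list (l : List (Site 2)) :
    (∑' p : (Σ x : Site 2, G.Walk x x),
      (if 0 < p.2.length ∧ (∃ v ∈ p.2.support, v ∈ l) then
        ((1 : ℝ) / 4) ^ p.2.length / (p.2.length : ℝ) else 0)) = rwLoopMass G {v | v ∈ l} := by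
  unfold rwLoopMass
  refine tsum_congr fun p => ?_
  split_ifs with h1 h2 h2
  · rfl
  · exact absurd h1 (by simpa only [Set.mem_setOf_eq] using h2)
  · exact absurd h2 (by simpa only [Set.mem_setOf_eq] using h1)
  · rfl

/-- The right-hand factor of item `LoopErasureIdentity` is `F_η(Ω_δ) = rwLoopFactor` of the trace
of `η`. [folklore] -/
theorem exp_tsum_loops_meeting_list (l : List (Site 2)) :
    Real.exp (∑' p : (Σ x : Site 2, G.Walk x x),
      (if 0 < p.2.length ∧ (∃ v ∈ p.2.support, v ∈ l) then
        ((1 : ℝ) / 4) ^ p.2.length / (p.2.length : ℝ) else 0)) = rwLoopFactor G {v | v ∈ l} := by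
  rw [rwLoopFactor, tsum_loops_meeting_list]

/-- `F_W(A) = exp m > 0`. [folklore] -/
theorem rwLoopFactor_pos : 0 < rwLoopFactor G W := Real.exp_pos _

/-- `1 ≤ F_W(A)`. [folklore] -/
theorem one_le_rwLoopFactor : 1 ≤ rwLoopFactor G W :=
  Real.one_le_exp (rwLoopMass_nonneg G W)

/-- The void probability is positive. [folklore] -/
theorem loopSoupVoid_pos : 0 < loopSoupVoid G W := Real.exp_pos _

/-- The void probability is at most `1`. [folklore] -/
theorem loopSoupVoid_le_one : loopSoupVoid G W ≤ 1 :=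
  Real.exp_le_one_iff.2 (neg_nonpos.2 (rwLoopMass_nonneg G W))

/-- `void · F = 1`: the soup-void probability is the reciprocal of `F_W(A)`. [folklore] -/
theorem loopSoupVoid_mul_rwLoopFactor : loopSoupVoid G W * rwLoopFactor G W = 1 := by
  rw [loopSoupVoid, rwLoopFactor, ← Real.exp_add, neg_add_cancel, Real.exp_zero]

/-- `void(∅) = 1`. [folklore] -/
@[simp] theorem loopSoupVoid_empty : loopSoupVoid G ∅ = 1 := by
  simp [loopSoupVoid]

/-- The trivial walk contributes `1` to `G_A(a, a)`, so `1 ≤ G_A(a,a)`. [folklore] -/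
theorem one_le_rwGreen_self (a : Site 2) : 1 ≤ rwGreen G a a := by
  rw [rwGreen]
  refine le_trans ?_ (ENNReal.le_tsum (SimpleGraph.Walk.nil : G.Walk a a))
  simp

/-! ### The loop-erased random walk on a discrete domain -/

variable {Ω : Set ℂ} {δ : ℝ} {a b : Site 2}

/-- Two SAWs of `Ω_δ` with the same underlying walk are equal. [folklore] -/
theorem _root_.Literature.Probability.RandomPlanarGeometry.SAW.DomainSAW.eq_of_walk_eq
    {γ γ' : SAW.DomainSAW Ω δ a b} (h : γ.walk = γ'.walk) : γ = γ' := by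
  cases γ; cases γ'; cases h; rfl

/-- The loop erasure (Mathlib's `Walk.bypass`) of a walk of `Ω_δ` from `a` to `b`, as a SAW of
`Ω_δ`. [folklore] -/
def LERW.erase (ω : (discreteDomainGraph Ω δ).Walk a b) : SAW.DomainSAW Ω δ a b :=
  ⟨ω.bypass, ω.bypass_isPath⟩

/-- `(LERW.erase ω).walk = ω.bypass`. [folklore] -/
@[simp] theorem LERW.erase_walk (ω : (discreteDomainGraph Ω δ).Walk a b) :
    (LERW.erase ω).walk = ω.bypass := rfl

variable (Ω δ a b)

/-- The **loop-erased measure** on SAWs of `Ω_δ` from `a` to `b`: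
`q̂(η) = ∑_{ω : a → b, LE(ω) = η} q(ω) = ∑_{ω, bypass ω = η} (1/4)^{|ω|}` (Lawler 2018, §3, display
before Prop. 3.1, with `LE` rendered by Mathlib's `SimpleGraph.Walk.bypass` as in route
SAWLoopAvoidanceChaos), as a sum of weighted Dirac masses (the fibre sums in `ℝ≥0∞`).
[cite: Lawler2018, §3 (loop-erased measure q̂)] -/
def LERW.weight : Measure (SAW.DomainSAW Ω δ a b) :=
  Measure.sum fun η =>
    (∑' ω : (discreteDomainGraph Ω δ).Walk a b,
      if ω.bypass = η.walk then ((1 : ℝ≥0∞) / 4) ^ ω.length else 0) • Measure.dirac η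

/-- The **law of the chordal loop-erased random walk in `Ω_δ` from `a` to `b`**: the loop-erased
measure normalised by its total mass `G_{Ω_δ}(a, b)` (`LERW.weight_univ`), i.e. the law of
`bypass ω` for `ω` drawn from the walks `a → b` of `Ω_δ` with probability `∝ (1/4)^{|ω|}` (simple
random walk from `a` killed on leaving `Ω_δ`, weighted by its visits to `b`). By Lawler 2018
Prop. 3.4 and Prop. 5.2 (and reversal, Lawler 1991 Lemma 7.2.1) its density is
`4^{-|η|} F_η(Ω_δ) / G_{Ω_δ}(a,b)` — the route's item `LoopErasureIdentity`, not asserted here.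
Junk value `0` if no walk joins `a` to `b` in `Ω_δ` or if `G_{Ω_δ}(a,b) = ∞`.
[cite: Lawler2018, §3 and Proposition 3.4] -/
def LERW.law : Measure (SAW.DomainSAW Ω δ a b) :=
  (LERW.weight Ω δ a b Set.univ)⁻¹ • LERW.weight Ω δ a b

variable {Ω δ a b}

/-- `q̂` of a single SAW: the `(1/4)^{|ω|}`-mass of the walks erasing to it.
[cite: Lawler2018, §3 (loop-erased measure q̂)] -/
theorem LERW.weight_singleton (η : SAW.DomainSAW Ω δ a b) :
    LERW.weight Ω δ a b {η} =
      ∑' ω : (discreteDomainGraph Ω δ).Walk a b,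
        if ω.bypass = η.walk then ((1 : ℝ≥0∞) / 4) ^ ω.length else 0 := by
  rw [LERW.weight, Measure.sum_apply _ MeasurableSpace.measurableSet_top, tsum_eq_single η]
  · simp
  · intro η' hη'
    simp [hη']

/-- **Total mass of the loop-erased measure** `= G_{Ω_δ}(a, b)`: the fibres of the erasure
partition the walks from `a` to `b` ("`∑_η q̂(η) = q[𝒦_A(x,y)]`", Lawler 2018, §3).
[cite: Lawler2018, §3 (display after the definition of q̂)] -/
theorem LERW.weight_univ :
    LERW.weight Ω δ a b Set.univ = rwGreen (discreteDomainGraph Ω δ) a b := by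
  rw [LERW.weight, Measure.sum_apply _ MeasurableSpace.measurableSet_top]
  simp only [Measure.smul_apply, smul_eq_mul, mul_one,
    Measure.dirac_apply_of_mem (Set.mem_univ _)]
  rw [ENNReal.tsum_comm, rwGreen]
  refine tsum_congr fun ω => ?_
  rw [tsum_eq_single (LERW.erase ω)]
  · simp
  · intro η hη
    rw [if_neg]
    intro h
    exact hη (SAW.DomainSAW.eq_of_walk_eq (by rw [← h, LERW.erase_walk]))

/-- The LERW law is a probability measure as soon as `0 < G_{Ω_δ}(a,b) < ∞` (some walk joins `a`
to `b` in `Ω_δ`, and the killed walk is transient between them). [folklore] -/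
theorem LERW.isProbabilityMeasure_law (h0 : rwGreen (discreteDomainGraph Ω δ) a b ≠ 0)
    (htop : rwGreen (discreteDomainGraph Ω δ) a b ≠ ∞) :
    IsProbabilityMeasure (LERW.law Ω δ a b) := by
  constructor
  rw [LERW.law, Measure.smul_apply, LERW.weight_univ, smul_eq_mul, ENNReal.inv_mul_cancel h0 htop]

/-- The LERW law of a single SAW: `q̂(η) / G_{Ω_δ}(a,b)`. [cite: Lawler2018, §3 and Proposition 3.4] -/
theorem LERW.law_singleton (η : SAW.DomainSAW Ω δ a b) :
    LERW.law Ω δ a b {η} =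
      (rwGreen (discreteDomainGraph Ω δ) a b)⁻¹ *
        ∑' ω : (discreteDomainGraph Ω δ).Walk a b,
          if ω.bypass = η.walk then ((1 : ℝ≥0∞) / 4) ^ ω.length else 0 := by
  rw [LERW.law, Measure.smul_apply, LERW.weight_univ, LERW.weight_singleton, smul_eq_mul]

end Literature.Probability.LatticeModels
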